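import Summits.NavierStokesRegularity.FluidComputer.SobolevLadderFront
import Summits.NavierStokesRegularity.NavierStokesRegularity.Theorems.FluidComputerCascade
import HarnessLib

/-!
# Fluid computer — the SOBOLEV LADDER, III: the ladder face assembled, and read on the cell's interface

HONEST FRAMING (cell `pub-fluidc`, verbatim): *low prior, high value-of-information experiment on Tao's
machine paradigm; NOT a claim that NS blows up.* Theorem side of the cell; nothing here is evidence of blow-up.

One statement for the paper's §4 out of `SobolevLadder` / `SobolevLadderFront` (L51–L51⁗), in the shape of the
earlier assembled faces (`LerayTimeFace.time_face`, `CriticalFace.critical_face`):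

* `ladder_face` — for every Sobolev index `s ∈ (1/2, 3/2]` one constant `c_s > 0` such that along every maximal
  smooth Leray–Hopf solution of the unforced Navier–Stokes system on `ℝ³` (`ν > 0`): (C) the `s`-row of the level
  table `L_s(t) = ∑_j 2^{sj} ‖Δ̇_j u(t)‖₂` obeys `c_s ν^{(5−2s)/4} (T − t)^{−(2s−1)/4} ≤ L_s(t)` at every `t ∈ (0, T)`;
  (D) `L_s(t) → ∞` as `t ↑ T`; (F) at every `t` and every level `J` the clock's left side is at most the head
  allowance `C₂ ‖u(0)‖₂ 2^{s(J−1)} G_s` plus the `s`-row above `J`; (A) for every `J` the `s`-row above `J` tends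
  to `∞` as `t ↑ T`;
* `ladder_face_of_cascadeWitness` — the same read on the cell's interface: every `CascadeWitness` (bp3) yields,
  via `x5a_of_cascadeWitness'`, a maximal smooth Leray–Hopf solution on which (C)(D)(A) hold for every
  `s ∈ (1/2, 3/2]` — companion of `CascadeWitnessFloor`, `CascadeWitnessClock.time_face_of_cascadeWitness` and
  `CriticalFace.critical_face_of_cascadeWitness`.

Reading (words): whatever level currency `s` between the critical one (`1/2`) and the amplitude one (`3/2`) a run
is scored in, a realised blow-up drives that row to infinity at a rate no slower than `(T − t)^{−(2s−1)/4}`, and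
the divergence sits above every fixed level; the exponent is linear in `s` and fixed by scaling. HONEST SIZE NOTE:
`c_s` inexplicit and `s`-dependent; `Ḃ^s_{2,1}` (ℓ¹-over-levels) currency; class = `ℝ³` finite energy. Necessity
only; nothing about sufficiency. 0 sorry; no new definitions, no named facts.

## References

* J. C. Robinson, W. Sadowski, Rend. Semin. Mat. Univ. Padova 131 (2014) 159–178, Corollaries 9–10.
  [RobinsonSadowski2014]
* J. Leray, Acta Math. 63 (1934), §19 (3.8)–(3.9) p. 224, §22 p. 227. [Leray1934]
* H. Bahouri, J.-Y. Chemin, R. Danchin, *Fourier Analysis and Nonlinear PDE*, Springer 2011, Lemma 2.1,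
  Prop. 2.12. [BahouriCheminDanchin2011]
-/

noncomputable section

open MeasureTheory Set Function Filter Topology Metric
open scoped ENNReal NNReal
open Literature.Analysis.FluidPDE Literature.Analysis.FunctionSpaces
open Literature.Analysis.FluidPDE.FluidComputer
open Summit.NavierStokesRegularity.NavierStokesRegularity.Theorems.FluidComputer (x5a_of_cascadeWitness')
open Summit.NavierStokesRegularity.FluidComputer.SobolevLadder
open Summit.NavierStokesRegularity.FluidComputer.SobolevLadderFront

namespace Summit.NavierStokesRegularity.FluidComputer.SobolevLadderFace

/-- **THE LADDER FACE, ASSEMBLED.** For every `s ∈ (1/2, 3/2]` there is `c = c_s > 0` such that for every `ν > 0`,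
`T > 0` and every maximal smooth solution `(u, p)` of the unforced Navier–Stokes system on `ℝ³ × [0, T)` which is
Leray–Hopf from `u 0`, with `C₂ = (lpBounds (Fin 3)).C₂`, `G_s = ∑_n 2^{−sn}` and `a_j(t) = ‖Δ̇_j u(t)‖₂`:
(C) `c ν^{(5−2s)/4} (T − t)^{−(2s−1)/4} ≤ ∑_j 2^{sj} a_j(t)` at every `t ∈ (0, T)` (L51); (D) `∑_j 2^{sj} a_j(t) → ∞`
as `t ↑ T` (L51′); (F) at every `t ∈ (0, T)` and every `J ∈ ℤ`,
`c ν^{(5−2s)/4} (T − t)^{−(2s−1)/4} ≤ C₂ ‖u(0)‖₂ 2^{s(J−1)} G_s + ∑_{n≥0} 2^{s(J+n)} a_{J+n}(t)` (L51″); (A) for every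
`J ∈ ℤ`, `∑_{n≥0} 2^{s(J+n)} a_{J+n}(t) → ∞` as `t ↑ T` (L51⁗). [cite: RobinsonSadowski2014, Corollary 10]
[cite: Leray1934, §22 p. 227] [cite: BahouriCheminDanchin2011, Lemma 2.1 and Prop. 2.12] -/
theorem ladder_face (s : ℝ) (hs : s ∈ Ioc (1 / 2 : ℝ) (3 / 2)) :
    ∃ c : ℝ, 0 < c ∧ ∀ (ν T : ℝ), 0 < ν → 0 < T →
      ∀ (u : ℝ → EuclideanSpace ℝ (Fin 3) → EuclideanSpace ℝ (Fin 3)) (p : ℝ → EuclideanSpace ℝ (Fin 3) → ℝ),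
      IsMaximalSmoothSolution ν 0 u p T → IsLerayHopfOn T ν 0 (u 0) u →
      (∀ t ∈ Ioo 0 T,
        ENNReal.ofReal (c * ν ^ ((5 - 2 * s) / 4) * (T - t) ^ (-((2 * s - 1) / 4))) ≤
          ∑' j : ℤ, (2 : ℝ≥0∞) ^ (s * (j : ℝ)) * blockL2 (u t) j) ∧
      Tendsto (fun t => ∑' j : ℤ, (2 : ℝ≥0∞) ^ (s * (j : ℝ)) * blockL2 (u t) j) (𝓝[<] T) (𝓝 ∞) ∧
      (∀ t ∈ Ioo 0 T, ∀ J : ℤ,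
        ENNReal.ofReal (c * ν ^ ((5 - 2 * s) / 4) * (T - t) ^ (-((2 * s - 1) / 4))) ≤
          ((lpBounds (Fin 3)).C₂ : ℝ≥0∞) * eLpNorm (u 0) 2 volume * (2 : ℝ≥0∞) ^ (s * ((J - 1 : ℤ) : ℝ)) *
              (∑' n : ℕ, ((2 : ℝ≥0∞) ^ (-s)) ^ n) +
            ∑' n : ℕ, (2 : ℝ≥0∞) ^ (s * ((J + n : ℤ) : ℝ)) * blockL2 (u t) (J + n)) ∧
      ∀ J : ℤ, Tendsto (fun t => ∑' n : ℕ, (2 : ℝ≥0∞) ^ (s * ((J + n : ℤ) : ℝ)) * blockL2 (u t) (J + n))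
        (𝓝[<] T) (𝓝 ∞) := by
  -- one constant serves (C) and (F): `ladder_front_clock` is `ladder_clock`'s constant fed through the head bound,
  -- but the two existentials need not agree; take the minimum.
  obtain ⟨c₁, hc₁, H₁⟩ := ladder_clock s hs
  obtain ⟨c₂, hc₂, H₂⟩ := ladder_front_clock s hs
  refine ⟨min c₁ c₂, lt_min hc₁ hc₂, fun ν T hν hT u p hmax hLH => ⟨fun t ht => ?_, ?_, fun t ht J => ?_, ?_⟩⟩
  · refine le_trans (ENNReal.ofReal_le_ofReal ?_) (H₁ ν T hν hT u p hmax hLH t ht)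
    have hX : 0 ≤ ν ^ ((5 - 2 * s) / 4) * (T - t) ^ (-((2 * s - 1) / 4)) := by
      have hTt : 0 < T - t := sub_pos.2 ht.2
      positivity
    calc min c₁ c₂ * ν ^ ((5 - 2 * s) / 4) * (T - t) ^ (-((2 * s - 1) / 4))
        = min c₁ c₂ * (ν ^ ((5 - 2 * s) / 4) * (T - t) ^ (-((2 * s - 1) / 4))) := by ring
      _ ≤ c₁ * (ν ^ ((5 - 2 * s) / 4) * (T - t) ^ (-((2 * s - 1) / 4))) :=
          mul_le_mul_of_nonneg_right (min_le_left _ _) hX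
      _ = c₁ * ν ^ ((5 - 2 * s) / 4) * (T - t) ^ (-((2 * s - 1) / 4)) := by ring
  · exact ladder_tendsto_top s hs hν hT hmax hLH
  · refine le_trans (ENNReal.ofReal_le_ofReal ?_) (H₂ ν T hν hT u p hmax hLH t ht J)
    have hX : 0 ≤ ν ^ ((5 - 2 * s) / 4) * (T - t) ^ (-((2 * s - 1) / 4)) := by
      have hTt : 0 < T - t := sub_pos.2 ht.2
      positivity
    calc min c₁ c₂ * ν ^ ((5 - 2 * s) / 4) * (T - t) ^ (-((2 * s - 1) / 4))
        = min c₁ c₂ * (ν ^ ((5 - 2 * s) / 4) * (T - t) ^ (-((2 * s - 1) / 4))) := by ring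
      _ ≤ c₂ * (ν ^ ((5 - 2 * s) / 4) * (T - t) ^ (-((2 * s - 1) / 4))) :=
          mul_le_mul_of_nonneg_right (min_le_right _ _) hX
      _ = c₂ * ν ^ ((5 - 2 * s) / 4) * (T - t) ^ (-((2 * s - 1) / 4)) := by ring
  · exact fun J => ladder_tail_tendsto_top s hs hν hT hmax hLH J

/-- **THE LADDER FACE READ ON THE INTERFACE: every cascade witness climbs every rung of the Sobolev ladder at
Leray's rate.** Every `W : CascadeWitness` yields `ν > 0`, `T > 0` and a maximal smooth solution `(u, p)` of the
unforced Navier–Stokes system on `ℝ³ × [0, T)`, Leray–Hopf from `u 0` (`x5a_of_cascadeWitness'`), such that for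
EVERY `s ∈ (1/2, 3/2]`, with the constant `c_s` of `ladder_face`: (C) `c_s ν^{(5−2s)/4} (T − t)^{−(2s−1)/4} ≤
∑_j 2^{sj} ‖Δ̇_j u(t)‖₂` at every `t ∈ (0, T)`, (D) the `s`-row tends to `∞` as `t ↑ T`, and (A) so does the `s`-row
above every fixed level `J`. Companion of `CascadeWitnessFloor`, `CascadeWitnessClock.time_face_of_cascadeWitness`,
`CriticalFace.critical_face_of_cascadeWitness`. [cite: RobinsonSadowski2014, Corollary 10]
[cite: Leray1934, §22 p. 227] -/
theorem ladder_face_of_cascadeWitness (W : CascadeWitness) :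
    ∃ ν : ℝ, 0 < ν ∧ ∃ T : ℝ, 0 < T ∧
      ∃ (u : ℝ → EuclideanSpace ℝ (Fin 3) → EuclideanSpace ℝ (Fin 3)) (p : ℝ → EuclideanSpace ℝ (Fin 3) → ℝ),
        IsMaximalSmoothSolution ν 0 u p T ∧ IsLerayHopfOn T ν 0 (u 0) u ∧
        ∀ s : ℝ, ∀ hs : s ∈ Ioc (1 / 2 : ℝ) (3 / 2),
          (∀ t ∈ Ioo 0 T,
            ENNReal.ofReal ((ladder_face s hs).choose * ν ^ ((5 - 2 * s) / 4) * (T - t) ^ (-((2 * s - 1) / 4))) ≤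
              ∑' j : ℤ, (2 : ℝ≥0∞) ^ (s * (j : ℝ)) * blockL2 (u t) j) ∧
          Tendsto (fun t => ∑' j : ℤ, (2 : ℝ≥0∞) ^ (s * (j : ℝ)) * blockL2 (u t) j) (𝓝[<] T) (𝓝 ∞) ∧
          ∀ J : ℤ, Tendsto (fun t => ∑' n : ℕ, (2 : ℝ≥0∞) ^ (s * ((J + n : ℤ) : ℝ)) * blockL2 (u t) (J + n))
            (𝓝[<] T) (𝓝 ∞) := by
  obtain ⟨ν, hν, T, hT, u, p, hmax, hLH, -⟩ := x5a_of_cascadeWitness' W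
  refine ⟨ν, hν, T, hT, u, p, hmax, hLH, fun s hs => ?_⟩
  obtain ⟨hC, hD, -, hA⟩ := (ladder_face s hs).choose_spec.2 ν T hν hT u p hmax hLH
  exact ⟨hC, hD, hA⟩

end Summit.NavierStokesRegularity.FluidComputer.SobolevLadderFace

end
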